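import Summits.BirchSwinnertonDyer.BirchSwinnertonDyer.Theorems.KatoDescentPotSupersingularFineSelmerDescentBigImage
import HarnessLib

/-!
# Two corollaries of the fine-road descent of Kato's Thm. 14.5 (3): (A) Kato's OWN zeta class on the big-image rows
# (the Iwasawa half of A161, member-free over Z0, modulo {Z0, 13.4}); (B) the `(Sel₀)_Γ`-free form under the
# structural hypothesis «`X₀(W/ℚ_∞)` has no non-zero finite Λ-submodule»

Seat `bsd-potss-rkm` g16 (prover; cell `bsd-potss`); `--supports stmt-BirchSwinnertonDyer-19196 --as helper` (crux M; the same
descent serves the irreducible rows of 19199/`PublishedInputsO6`); closes nothing; ROUTE-FREE.  HONEST FRAMING: BSD is not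
proved by any of this; nothing is booked; hypothesis (NF) of §B is NOT asserted for any curve.

* §A `exists_zetaLift_natCard_fineSelmer_mul_descentCokernel_dvd_of_imageContainsSL2` — for `W/ℚ` elliptic with
  `Im ρ_{W,p} ⊇ SL₂(ℤ_p)`, `p ≠ 2`, `W(ℚ)`, `Ш(W)[p^∞]` finite, `L(W,1) ≠ 0`, `f` a newform of `W`, the cyclotomic `(κ, γ)`,
  pinned `I`, any `Y`: there is a non-zero genuine Λ-adic Euler-system class `𝐲` (the lift of Kato's `(c,d,a(A))`-zeta family
  for an admissible datum, rkm g14/g15) with `𝐲₀` of infinite order (from the VALUE, rkm g10), `X₀` torsion,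
  `char_Λ(𝐇¹_Γ/Λ𝐲) ⊆ char_Λ X₀`, `#Sel₀(W/ℚ_∞)^Γ · #desc ∣ #Sel₀(W/ℚ_∞)_Γ · [H¹(ℤ[1/p],T_pW) : ℤ_p 𝐲₀]` and the level-0
  form — modulo {Z0 `exists_member_eulerSystem_expStar_values`, `thm13_4_…`} ONLY (no Serre, no FW, no Lim, no `μ`).
* §B `natCard_endCoinvariants_eq_one_of_forall_finite_eq_bot` — if `X₀` is torsion with `X₀/TX₀` finite and (NF) every finite
  Λ-submodule of `X₀` is `0`, then `Sel₀(W/ℚ_∞)_Γ = 0` (`X₀[T]` is a finite submodule, Greenberg L.4.2); hence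
  (`…_of_charIdeal_le_of_forall_finite_eq_bot`) under (NF) the descent reads
  `#Sel₀(W/ℚ_∞)^Γ · #desc ∣ [H¹(ℤ[1/p],T_pW) : ℤ_p s₀]` and `#Sel₀(ℚ, W[p^∞]) · #desc ∣ #W[p^∞]^{Γ_ℚ} · [H¹(ℤ[1/p],T_pW) : ℤ_p s₀]`
  — the EXACT level-0 shape of Kato's `#H²(ℤ[1/p],T) ≤ [H¹(ℤ[1/p],T) : z]` (memo FINDING-19196-rkm-g16: without (NF) the term
  `#Sel₀(W/ℚ_∞)_Γ = #Sel₀^Γ·#desc·p^{t₀−t_p}/#Sel₀^{ur}(ℚ)` needs (14.14.2)/Poitou–Tate).  (NF) for the CLASSICAL Selmer group at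
  an ordinary prime is Greenberg LNM 1716 Prop. 4.14–4.15; for `X₀` it is a question (Wuthrich 2007), not an input of the tree.

References: [Kato2004Asterisque] Thm. 12.5 (4)/(12.5.2) (p. 222), Thm. 13.4 (3) (p. 226), Thm. 14.5 (3) (p. 236), §14.14;
[GreenbergLNM1716] §4 Lemma 4.2, Prop. 4.14–4.15 (pp. 102–111).
-/

-- the summit and its single problem are both named `BirchSwinnertonDyer` (registry layout D-0017)
set_option linter.dupNamespace false
set_option autoImplicit false

noncomputable section

open scoped NumberField TensorProduct
open Field IsDedekindDomain WeierstrassCurve CongruenceSubgroup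
open Literature.NumberTheory.GaloisRepresentations Literature.NumberTheory.EllipticCurves
open Literature.NumberTheory.EllipticCurves.GreenbergSelmer Literature.NumberTheory.EllipticCurves.ModularForms
open Literature.NumberTheory.EllipticCurves.Kato2004 Literature.NumberTheory.EllipticCurves.Kato2004.EulerSystemValues
open Literature.NumberTheory.EllipticCurves.IwasawaAlgebra Literature.NumberTheory.EllipticCurves.IwasawaDual

namespace Summit.BirchSwinnertonDyer.BirchSwinnertonDyer.Theorems.FineSelmerDescentOfDivisibility

/-! ## §A Kato's own zeta class on the big-image rows, member-free over Z0 -/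

section ZetaBigImage

variable (W : WeierstrassCurve ℚ) [W.IsElliptic] (p : ℕ) [Fact p.Prime]
  [ContinuousSMul ℤ_[p] (W.tateModule p)] [Module.Free ℤ_[p] (W.tateModule p)]
  [Module.Finite ℤ_[p] (W.tateModule p)]
  [Finite W.toAffine.Point] [Finite (AddCommGroup.primaryComponent W.sha p)]
  {κ : ZpExtension ℚ p} {γ : absoluteGaloisGroup ℚ}

/-- **The Iwasawa half of A161 for Kato's own zeta class, kernel modulo {Z0, 13.4}.**  On a rank-0 row with Kato's
(12.5.2) (`ImageContainsSL2 W p`), `p ≠ 2`, `L(W,1) ≠ 0` and a newform `f` of `W`: there is a non-zero genuine Λ-adic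
Euler-system class `𝐲 ∈ 𝐇¹_Γ(T_pW)` with `proj₀ 𝐲` of infinite order such that `X₀(W/ℚ_∞)` is torsion,
`char_Λ(𝐇¹_Γ/Λ𝐲) ⊆ char_Λ X₀`, `#Sel₀(W/ℚ_∞)^Γ · #(H¹(ℤ[1/p],T_pW)/proj₀(𝐇¹_Γ/T)) ∣ #Sel₀(W/ℚ_∞)_Γ · [H¹(ℤ[1/p],T_pW) : ℤ_p 𝐲₀]`
and `#Sel₀(ℚ, W[p^∞]) · #(H¹(ℤ[1/p],T_pW)/proj₀(𝐇¹_Γ/T)) ∣ #W[p^∞]^{Γ_ℚ} · #Sel₀(W/ℚ_∞)_Γ · [H¹(ℤ[1/p],T_pW) : ℤ_p 𝐲₀]`.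
[cite: Kato2004Asterisque, Thm. 12.5 (4) with (12.5.2) and Thm. 12.6 (p. 222), Thm. 13.4 (3) (p. 226), Thm. 14.5 (p. 236)]
[cite: GreenbergLNM1716, §4 Lemmas 4.2–4.3 (pp. 102–103)] -/
theorem exists_zetaLift_natCard_fineSelmer_mul_descentCokernel_dvd_of_imageContainsSL2
    (hZ0 : exists_member_eulerSystem_expStar_values)
    (h134 : thm13_4_lengthAt_fineSelmerDual_le_of_isEulerSystemClass)
    (hp : p ≠ 2) (hκ : κ.IsCyclotomic) (hγ : κ.IsTopGenerator γ) (hSL2 : ImageContainsSL2 W p)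
    (I : IwasawaH1Data W p κ γ) (Y : W.FineSelmerDualData κ γ)
    {N : ℕ} [NeZero N] (f : CuspForm (Gamma0 N) 2) (hf : IsNewformOf W f) (hL1 : W.entireLFunction 1 ≠ 0)
    (ι : (m : ℕ) → (CyclotomicField m ℚ →+* ℂ)) :
    ∃ y : I.H, y ≠ 0 ∧ IsEulerSystemClass W p κ γ I y ∧ ¬ IsOfFinAddOrder (I.proj 0 y) ∧
      Module.IsTorsion (IwasawaAlgebra p) Y.X ∧
      Module.charIdeal (IwasawaAlgebra p) (I.H ⧸ Submodule.span (IwasawaAlgebra p) {y}) ≤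
        Module.charIdeal (IwasawaAlgebra p) Y.X ∧
      (Nat.card (endInvariants (W.conjFineSelmerInfty κ γ - 1)) * Nat.card I.descentCokernel ∣
        Nat.card (EndCoinvariants (W.conjFineSelmerInfty κ γ - 1)) *
          Nat.card (integralH1 (tateRep W p) p (κ.layerSubgroup 0) ⧸
            Submodule.span ℤ_[p] {(⟨I.proj 0 y, I.proj_mem 0 y⟩ :
              integralH1 (tateRep W p) p (κ.layerSubgroup 0))})) ∧
      Nat.card (strictSelmerGroupOver (κ.layerSubgroup 0) (W.geomPrimaryTorsion p) p
          (fineData (W.geomPrimaryTorsion p) p)) * Nat.card I.descentCokernel ∣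
        Nat.card {m : W.geomPrimaryTorsion p | ∀ σ : absoluteGaloisGroup ℚ, σ • m = m} *
          Nat.card (EndCoinvariants (W.conjFineSelmerInfty κ γ - 1)) *
            Nat.card (integralH1 (tateRep W p) p (κ.layerSubgroup 0) ⧸
              Submodule.span ℤ_[p] {(⟨I.proj 0 y, I.proj_mem 0 y⟩ :
                integralH1 (tateRep W p) p (κ.layerSubgroup 0))}) := by
  obtain ⟨κ', hκ', Λ', hΛ'⟩ := forall_exists_zetaBody_of_member hZ0 W p f hf ι
  obtain ⟨c, d, a, A, d', hA, hc, hd, hcd, hdd', hR⟩ := valueGuard_satisfiable f hf.1 hf.coeffField_eq_bot p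
  obtain ⟨z, x, hbody⟩ := hΛ' c d a A hA hc hd
  have hne : 2 * c.natAbs * d.natAbs * A * N ≠ 0 :=
    ReducibleZetaDivisibility.two_mul_natAbs_ne_zero_of_gcd (p := p) hA hc hd
  obtain ⟨y, hy, -⟩ := IwasawaH1Data.existsUnique_lift_of_zetaBody p W hκ hp I f ι κ' Λ' c d a A z x hbody
  have hnt : ¬ IsOfFinAddOrder (I.proj 0 y) :=
    MemberIndexOfValue.not_isOfFinAddOrder_proj_zero_of_zetaBody hκ hp hbody hκ' hf hL1 hA d' hcd hdd' hR hy
  have hy0 : y ≠ 0 := by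
    rintro rfl
    exact hnt (by rw [map_zero]; exact isOfFinAddOrder_iff_nsmul_eq_zero.mpr ⟨1, one_pos, by simp⟩)
  have hES := isEulerSystemClass_of_zetaBody W p hκ hp I hbody hne hy
  exact ⟨y, hy0, hES, hnt,
    natCard_fineSelmer_mul_descentCokernel_dvd_of_imageContainsSL2 W p h134 hp hκ hγ hSL2 I Y y hES hnt⟩

end ZetaBigImage

/-! ## §B Under (NF) «no non-zero finite Λ-submodule of `X₀`» the `(Sel₀)_Γ` term disappears -/

section NoFinite

variable (W : WeierstrassCurve ℚ) [W.IsElliptic] (p : ℕ) [Fact p.Prime]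
  [ContinuousSMul ℤ_[p] (W.tateModule p)]
  [Finite W.toAffine.Point] [Finite (AddCommGroup.primaryComponent W.sha p)]
  {κ : ZpExtension ℚ p} {γ : absoluteGaloisGroup ℚ}

omit [W.IsElliptic] [ContinuousSMul ℤ_[p] (W.tateModule p)] [Finite W.toAffine.Point]
  [Finite (AddCommGroup.primaryComponent W.sha p)] in
/-- **`Sel₀(W/ℚ_∞)_Γ = 0` under (NF).**  If `X₀` is finitely generated torsion with `Sel₀(W/ℚ_∞)_Γ` finite (e.g. by the
descent) and every finite Λ-submodule of `X₀` vanishes, then `#Sel₀(W/ℚ_∞)_Γ = 1`: `X₀[T] ≅ (Sel₀_Γ)^∨` is a finite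
Λ-submodule. [cite: GreenbergLNM1716, §4 Lemma 4.2 (p. 102) and Prop. 4.14 (p. 109)] -/
theorem natCard_endCoinvariants_eq_one_of_forall_finite_eq_bot (hγ : κ.IsTopGenerator γ)
    (Y : W.FineSelmerDualData κ γ) (hfin : Finite (EndCoinvariants (W.conjFineSelmerInfty κ γ - 1)))
    (hNF : ∀ N : Submodule (IwasawaAlgebra p) Y.X, Finite N → N = ⊥) :
    Nat.card (EndCoinvariants (W.conjFineSelmerInfty κ γ - 1)) = 1 := by
  have hD := Y.isDualPair hγ
  haveI : Finite (invariants p Y.X) := hD.finite_invariants_iff.mpr hfin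
  rw [← hD.natCard_invariants, hNF (invariants p Y.X) inferInstance]
  exact Nat.card_unique

/-- **Under (NF), the `Γ`-level descent has no `(Sel₀)_Γ` factor**: with the row-free, `μ`-free hypotheses (`X₀` torsion,
`proj₀ s` of infinite order on a rank-0 row, `char_Λ(𝐇¹_Γ/Λs) ⊆ char_Λ X₀`) and (NF):
`#Sel₀(W/ℚ_∞)^Γ · #(H¹(ℤ[1/p],T_pW)/proj₀(𝐇¹_Γ/T)) ∣ [H¹(ℤ[1/p],T_pW) : ℤ_p s₀]` — Kato's `#H²(ℤ[1/p],T) ≤ [H¹(ℤ[1/p],T) : z]`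
read with `#Sel₀(W/ℚ_∞)^Γ` for `#𝐇²_Γ/#𝐇²[T]`. [cite: Kato2004Asterisque, Thm. 14.5 (3) (p. 236), §14.14 (pp. 243–244)]
[cite: GreenbergLNM1716, §4 Lemma 4.2, Prop. 4.14 (pp. 102, 109)] -/
theorem natCard_fineSelmer_invariants_mul_descentCokernel_dvd_of_charIdeal_le_of_forall_finite_eq_bot
    (hκ : κ.IsCyclotomic) (hγ : κ.IsTopGenerator γ) (I : IwasawaH1Data W p κ γ) (Y : W.FineSelmerDualData κ γ)
    (hYtors : Module.IsTorsion (IwasawaAlgebra p) Y.X) (hNF : ∀ N : Submodule (IwasawaAlgebra p) Y.X, Finite N → N = ⊥)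
    (s : I.H) (hnt : ¬ IsOfFinAddOrder (I.proj 0 s))
    (hchar : Module.charIdeal (IwasawaAlgebra p) (I.H ⧸ Submodule.span (IwasawaAlgebra p) {s}) ≤
      Module.charIdeal (IwasawaAlgebra p) Y.X) :
    Nat.card (endInvariants (W.conjFineSelmerInfty κ γ - 1)) * Nat.card I.descentCokernel ∣
      Nat.card (integralH1 (tateRep W p) p (κ.layerSubgroup 0) ⧸
        Submodule.span ℤ_[p] {(⟨I.proj 0 s, I.proj_mem 0 s⟩ : integralH1 (tateRep W p) p (κ.layerSubgroup 0))}) := by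
  obtain ⟨-, hfin, -, -, h⟩ := natCard_fineSelmer_invariants_mul_descentCokernel_dvd_of_charIdeal_le' W p hκ hγ I Y
    hYtors s hnt hchar
  rwa [natCard_endCoinvariants_eq_one_of_forall_finite_eq_bot W p hγ Y hfin hNF, one_mul] at h

/-- **Under (NF), at LEVEL 0**: `#Sel₀(ℚ, W[p^∞]) · #(H¹(ℤ[1/p],T_pW)/proj₀(𝐇¹_Γ/T)) ∣ #W[p^∞]^{Γ_ℚ} · [H¹(ℤ[1/p],T_pW) : ℤ_p s₀]`
— compare Kato: `#H²(ℤ[1/p],T) = #Ш¹_{p,∞}(ℚ, W[p^∞]) · p^{t_p − t₀} ≤ [H¹(ℤ[1/p],T) : z]`.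
[cite: Kato2004Asterisque, Thm. 14.5 (3) (p. 236), §14.9 (14.9.3) (p. 240), §14.14 (pp. 243–244)] [cite: GreenbergLNM1716, §4 Lemmas 4.2–4.3] -/
theorem natCard_fineSelmerZero_mul_descentCokernel_dvd_of_charIdeal_le_of_forall_finite_eq_bot
    (hκ : κ.IsCyclotomic) (hγ : κ.IsTopGenerator γ) (I : IwasawaH1Data W p κ γ) (Y : W.FineSelmerDualData κ γ)
    (hYtors : Module.IsTorsion (IwasawaAlgebra p) Y.X) (hNF : ∀ N : Submodule (IwasawaAlgebra p) Y.X, Finite N → N = ⊥)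
    (s : I.H) (hnt : ¬ IsOfFinAddOrder (I.proj 0 s))
    (hchar : Module.charIdeal (IwasawaAlgebra p) (I.H ⧸ Submodule.span (IwasawaAlgebra p) {s}) ≤
      Module.charIdeal (IwasawaAlgebra p) Y.X) :
    Nat.card (strictSelmerGroupOver (κ.layerSubgroup 0) (W.geomPrimaryTorsion p) p
        (fineData (W.geomPrimaryTorsion p) p)) * Nat.card I.descentCokernel ∣
      Nat.card {m : W.geomPrimaryTorsion p | ∀ σ : absoluteGaloisGroup ℚ, σ • m = m} *
        Nat.card (integralH1 (tateRep W p) p (κ.layerSubgroup 0) ⧸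
          Submodule.span ℤ_[p] {(⟨I.proj 0 s, I.proj_mem 0 s⟩ : integralH1 (tateRep W p) p (κ.layerSubgroup 0))}) := by
  obtain ⟨-, hfin, -, -, -⟩ := natCard_fineSelmer_invariants_mul_descentCokernel_dvd_of_charIdeal_le' W p hκ hγ I Y
    hYtors s hnt hchar
  have h := natCard_fineSelmerZero_mul_descentCokernel_dvd_of_charIdeal_le' W p hκ hγ I Y hYtors s hnt hchar
  rwa [natCard_endCoinvariants_eq_one_of_forall_finite_eq_bot W p hγ Y hfin hNF, mul_one] at h

end NoFinite

end Summit.BirchSwinnertonDyer.BirchSwinnertonDyer.Theorems.FineSelmerDescentOfDivisibility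

end
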